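import Mathlib.Topology.Algebra.Module.FiniteDimension
import Mathlib.Analysis.Normed.Operator.Bilinear
import Mathlib.LinearAlgebra.FiniteDimensional.Lemmas
import Mathlib.Data.Nat.Find
import Mathlib.Tactic.Module
import Mathlib.RingTheory.Norm.Transitivity
import Mathlib.RingTheory.Complex
import Mathlib.Topology.Algebra.Module.Determinant
import Mathlib.LinearAlgebra.Complex.Module
import Mathlib.Analysis.Quaternion
import Literature.Geometry.Hyperkaehler.NoFormsInvariantUnderAllComplexStructures
import HarnessLib

/-!
# Adapted bases `(e_a, I e_a)` of a complex structure and the block basis `⟨v, Iv, Jv, IJv⟩` of a quaternionic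
# pair on a real vector space: `GL(V_ℝ)` is transitive on complex structures, `G_I` is transitive on the complex
# structures anticommuting with `I` (Prop. 1.3) and on quaternionic pairs (Lemma 4.1), `G_I < GL⁺(V_ℝ)` and the
# `GL⁺` form of Lemma 4.1, every complex structure of a `4n`-dimensional space has an anticommuting partner, and every
# quaternionic pair has a hyperkähler metric (Prop. 1.2) (Buskin–Izadi 2020, §1.1–§1.3, §4)

Topic `Literature/Geometry/Hyperkaehler`, namespace `Literature.Geometry.Hyperkaehler.ComplexStructure`. Written by the
literature seat `lit-w-verbitsky` (gen 11) of the cell `pub-hsemireg` (HodgeConjecture venture), 2026-08-24, as the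
linear-algebra leg of rows V-V8 / V-V13 / V-V20 (twistor lines in the period domain `Compl` of complex tori) of that
cell's Verbitsky table, and as the input "every complex structure of a torus of even complex dimension is compatible
with some hyperkähler structure" of the torus half of Verbitsky 2008 Rem. 4.3 (`NoFormsInvariantUnderAllComplexStructures.lean`).
THEOREMS ONLY (no definition, no named fact, no `sorry`).

## Source, verbatim (N. Buskin, E. Izadi, *Twistor lines in the period domain of complex tori*, arXiv:1806.07831v2
(28 Jun 2020; journal version Geom. Dedicata 213 (2021) 21–47, pages unseen), §1 "The space of twistor spheres";
page/line = text layer of the v2 PDF; the v1 (2018) variants that differ are quoted in the "Versions" paragraph below)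

* §1.1, p.5 L22–24: "Let `A` be a complex torus of dimension `2n`. Denote by `V_ℝ` the real tangent space `T_{ℝ,0}A`
  and by `V` the complex tangent space `T_{ℂ,0}A ⊂ T_{ℝ,0}A ⊗ ℂ`, so that `dim_ℝ V_ℝ = 2 dim_ℂ V = 4n`."
* §1.1, p.5 L28–31: "Explicitly, a complex structure `I : V_ℝ → V_ℝ` corresponds to the `2n`-plane
  `(1 − iI)V_ℝ ∈ Gr(2n, 4n) = Gr(2n, V_ℂ)` where `1` denotes the identity map. As a homogeneous space, `Compl` is the
  orbit of `I` under the conjugation action of `G := GL(V_ℝ)`: `Compl ≅ G/G_I`, where `G_I ≅ GL_{2n}(ℂ)` is the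
  stabilizer of `I`."
* §1.1, p.5 L36–38: "Assume that `J : V_ℝ → V_ℝ` is a complex structure anticommuting with `I`. Then `I` and `J`
  determine a twistor sphere `S(I, J) := {aI + bJ + cK | a² + b² + c² = 1}`, where `K = IJ`."
* §1.2, p.5 L46–p.6 L4: "Let `J` be a complex structure that anti-commutes with `I`. Then `V_ℝ` splits, in a
  non-unique way, as a direct sum of 4-dimensional subspaces of the form `⟨v, Iv, Jv, IJv⟩` for nonzero vectors
  `v ∈ V_ℝ`, and the union of the specified bases of the 4-subspaces forms a basis of `V_ℝ`. In this basis the matrix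
  of `J` has a block-diagonal form with the following `4×4` blocks on the diagonal […]."
* **Proposition 1.2** (p.6 L29–34): "Given a triple of complex structures `(I, J, K)` on `A` satisfying the
  quaternionic identities, there exist a (non-unique) metric `g` on `A` such that `(I, J, K)` is a hyperkähler
  structure with respect to `g`. Proof. Choose a basis of `V_ℝ` as in Paragraph 1.2 and define a metric `g(·,·)` on
  `V_ℝ` by declaring this basis to be orthonormal. Then `I, J` and `K` are isometries with respect to `g(·,·)` and `g` is
  Kähler with respect to all three complex structures."
* §1.3, p.6 L37–38: "By the definition of `Compl`, the group `G` acts transitively on it: `g ∈ G: J ↦ ᵍJ = gJg⁻¹`."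
  **Proposition 1.3** (p.6 L42–47): "The group `G_I` acts transitively on the set `N_I` of complex structures
  anticommuting with `I`. Proof. Let `J` be a complex structure that anti-commutes with `I`. The group
  `G_I ≅ GL(V) < GL⁺(V_ℝ) = GL⁺_{4n}(ℝ)` acts transitively on the set of bases as in Paragraph 1.2, hence also on the
  set of `J` anti-commuting with `I`."
* §4 **Lemma 4.1** (p.21 L32–37): "The group `G = GL(V_ℝ)` acts transitively on the set of twistor lines in `Compl`.
  Proof. Given two twistor spheres `S₁ = S(I₁, J₁)` and `S₂ = S(I₂, J₂)`, there is an element `g ∈ G` sending `I₁` to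
  `I₂`, hence sending `S₁` to a twistor sphere through `I₂`. The lemma now follows from Corollary 1.6."
* p.5 L35–36 (v2): "the period domain `Compl` consists of two connected components `Compl⁺` and `Compl⁻`, corresponding
  to the components `GL⁺(V_ℝ)` and `GL⁻(V_ℝ)` of `G`."

**Versions.** arXiv v1 (June 2018; the text held in this project's corpus store) differs where it matters here:
v1 §1.1 "Let `G := GL⁺(V_ℝ) ≅ GL⁺_{4n}(ℝ)` be the group of orientation-preserving automorphisms of `V_ℝ` … We consider
the set `Compl` of all complex structures on `V_ℝ` as the orbit of `I`: `Compl = G·I`, diffeomorphic to the homogeneous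
space `G/GL(V) ≅ GL⁺_{4n}(ℝ)/GL_{2n}(ℂ)`"; v1 numbering Prop. 1.2 / Cor. 1.3 / Cor. 1.5 / Prop. 1.6 = v2 Prop. 1.3 /
Cor. 1.4 / Cor. 1.6 / Prop. 1.7; v1 §4 "Lemma 4.1. The group `G = GL⁺(V_ℝ)` acts transitively on the set of twistor
lines in `Compl`." (same proof, "… follows from Corollary 1.5"), and v1 states the degree of twistor lines as `2` where
v2 has `2n`. Both forms of Lemma 4.1 are formalised below (§7: `G = GL(V_ℝ)`; §8: `G = GL⁺(V_ℝ)` with `Compl = G·I`);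
which letter the journal printed is not read here (want acq-10291).

## What is formalised (theorems only; `F` a finite-dimensional real normed space, "complex structure" = `L` with `L² = −1`)

* §1–§2 **`exists_adapted_basis`**: every complex structure `L` admits an ADAPTED BASIS `(e_a, L e_a)_{a<m}`
  (indexed by `Bool × Fin m`) — a maximal linearly independent adapted family spans, because the span `U` of an
  adapted family is `L`-stable (`map_span_adapted_le`) and a vector `v ∉ U` extends it
  (`linearIndependent_adapted_append`: `a v + b Lv ∈ U ⟹ (a² + b²) v ∈ U`); hence `dim_ℝ F = 2m` is even
  (`finrank_eq_two_mul_of_adapted_basis`, `even_finrank_of_complexStructure`) — "`G_I ≅ GL_{2n}(ℂ)`", "`dim_ℝ V_ℝ =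
  2 dim_ℂ V`".
* §3 **`exists_conj_of_complexStructure`**: "`G` acts transitively on `Compl`" — any two complex structures are
  conjugate by a (continuous) linear automorphism `g`, `g L₁ = L₂ g` (map adapted basis to adapted basis).
* §4 **`exists_anticommuting_complexStructure`**: in real dimension `4n` every complex structure `L` has a complex
  structure `J` with `JL = −LJ` (on an adapted basis with the `e`'s split in halves `e_a, e'_a`: `J e_a = e'_a`,
  `J e'_a = −e_a`, `J L e_a = −L e'_a`, `J L e'_a = L e_a` — the block shape `⟨v, Iv, Jv, IJv⟩` of §1.2), so `L`
  "determines twistor spheres `S(L, J)`".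
* §5 **`exists_invariant_inner`** (Prop. 1.2, linear form): for complex structures `L, J` with `JL = −LJ` there is a
  symmetric positive definite bilinear form invariant under `L` and `J` — proved here by AVERAGING an inner product over
  the group `{1, L, J, LJ}` (the printed proof declares a block basis orthonormal; the tree's
  `exists_isLinearHyperkaehler_of_anticommuting` of `TwistorLineHermitianFormSignature.lean` is the same averaging on a
  complex carrier); **`exists_hyperkaehler_of_finrank_eq`**: in real dimension `4n` EVERY complex structure is part of
  a linear hyperkähler structure `(L, J, g)` — on a complex torus of even complex dimension every complex structure is
  "compatible with some hyperkähler structure" (the clause of Verbitsky 2008 §4, p.668 L3–4, used by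
  `NoFormsInvariantUnderAllComplexStructures.lean`).
* §6 **`exists_pairAdapted_basis`** (§1.2 as printed): for complex structures `L, J` with `JL = −LJ` there are
  `e_0, …, e_{m−1}` with `(e_a, L e_a, J e_a, LJ e_a)_{a<m}` a basis (indexed by `(Bool × Bool) × Fin m`) — "`V_ℝ` splits
  … as a direct sum of 4-dimensional subspaces of the form `⟨v, Iv, Jv, IJv⟩` … and the union of the specified bases …
  forms a basis of `V_ℝ`" (same maximality argument; the extension step is
  `(a² + b² + c² + d²) v = a w − b Lw − c Jw − d LJw ∈ U` for `w = a v + b Lv + c Jv + d LJv ∈ U`);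
  `finrank_eq_four_mul_of_pair` (`dim_ℝ = 4m`).
* §7 **`exists_conj_of_pair`** (Lemma 4.1, linear form: "`G = GL(V_ℝ)` acts transitively on the set of twistor
  lines"): two quaternionic pairs `(L₁, J₁)`, `(L₂, J₂)` on the same space are simultaneously conjugate by one linear
  automorphism `g` (block basis ↦ block basis); **`exists_conj_of_anticommuting`** (Prop. 1.3, linear form): for `J, J'`
  both anticommuting with `L` there is `g` with `gL = Lg` (i.e. `g ∈ G_L ≅ GL(V, L)`) and `gJ = J'g` — "The group `G_I`
  acts transitively on the set `N_I` of complex structures anticommuting with `I`" ("`G_I` … acts transitively on the set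
  of bases as in Paragraph 1.2").
* §8 **`det_pos_of_commute_complexStructure`** ("`G_I ≅ GL(V) < GL⁺(V_ℝ)`"): a real automorphism commuting with a
  complex structure has positive determinant (transport to `(ℂ^m, i)` along an adapted basis, `det_ℝ = |det_ℂ|²`);
  **`det_mul_det_pos_of_conj`**: all conjugators of `L₁` onto `L₂` have determinants of one sign (the algebra behind
  "`Compl` consists of two connected components"); **`exists_conj_of_pair_of_det_pos`** (Lemma 4.1 in the v1 form
  `G = GL⁺(V_ℝ)`, `Compl = G·I`): if `L₂ = h L₁ h⁻¹` with `det h > 0`, the pair `(L₁, J₁)` is conjugate to `(L₂, J₂)` by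
  an orientation-PRESERVING `g` — the printed proof (move `I₁` to `I₂`, then `G_{I₂}`-transitivity on `N_{I₂}`);
  **`quaternion_det_neg_of_conj_left_right`**, **`exists_pairs_forall_conj_det_neg`** (sharpness, on Mathlib's `ℍ`):
  left and right multiplication by `i` on `ℍ = ℝ⁴` are conjugate only by maps of NEGATIVE determinant, so the
  `GL⁺`-orbit hypothesis is not automatic and v1's "`G = GL⁺(V_ℝ)`" needs v1's "`Compl = G·I`".
* §9 **`eq_zero_of_forall_hyperkaehlerCompatible_invariant`** (imports `NoFormsInvariantUnderAllComplexStructures.lean`):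
  the `𝔤₀`-FAITHFUL torus form of Verbitsky 2008 Rem. 4.3 at constant-form level — on a real space of dimension `4n` a
  `k`-covector (`0 < k < 4n`) fixed by every complex structure that is part of a linear hyperkähler structure
  `(L, J, g)` vanishes, because by §4–§5 EVERY complex structure is such.
## Scope (faithfulness)

(i) Linear algebra of one real vector space only (the tangent space `V_ℝ = T_{ℝ,0}A`; for a torus `A = V_ℝ/Λ` constant
complex structures and flat metrics descend, which is not formalised). (ii) Prop. 1.2 is proved by averaging, not by
the printed orthonormal declaration (either gives "a (non-unique) metric"); the `4×4` matrix display of §1.2 is the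
content of the block relations used in §6–§7, not transcribed as a matrix. (iii) `Compl`, `Gr(2n, 4n)`, the period
map, the groups `G`, `G_I`, `GL(V, ℍ)` as Lie groups, Cor. 1.4–1.6 (dimension counts, `N_I ≅ GL(V)/GL(V, ℍ)`), §1.5,
Lemma 1.1, Prop. 1.7, the topology of `Compl` (connected components as spaces) and the degree computation of §4 are
NOT formalised; "acts transitively" is rendered as the existence of a conjugating (continuous) linear automorphism,
"orientation-preserving" as `0 < det`. (iv) The `ℍ` example of §8b is this file's illustration (folklore), not a
statement of the source.

## References

* [BuskinIzadi2020TwistorLinesTori] N. Buskin, E. Izadi, *Twistor lines in the period domain of complex tori*, Geom.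
  Dedicata 213 (2021) 21–47 = arXiv:1806.07831v2, §1.1 (p.5 L22–44), §1.2 (p.5 L45–p.6 L28), Prop. 1.2 (p.6 L29–35),
  §1.3 with Prop. 1.3 (p.6 L36–48), §4 Lemma 4.1 (p.21 L32–37) — read on the arXiv v2 PDF (journal pages unseen,
  want acq-10291); arXiv v1 (2018) §1.1–§1.3, §4 read in the corpus text (store key `paper:arxiv-1806.07831`) for the
  "Versions" paragraph.
* [Joyce2007] D. Joyce, *Riemannian Holonomy Groups and Calibrated Geometry* (2007), §10.1.1 (averaging a Hermitian
  metric over `J`) — the tree's precedent for §5.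
-/

noncomputable section

open Module Submodule

namespace Literature.Geometry.Hyperkaehler.ComplexStructure

variable {F : Type*} [NormedAddCommGroup F] [NormedSpace ℝ F]

/-! ### §1 The span of an adapted family is stable; one more vector extends the family -/

/-- The span of an adapted family `(e_a, L e_a)_a` is `L`-stable. [folklore] -/
private theorem map_span_adapted_le {L : F →L[ℝ] F} (hL : ∀ v, L (L v) = -v) {j : ℕ} (e : Fin j → F) :
    ∀ x ∈ span ℝ (Set.range fun s : Bool × Fin j ↦ bif s.1 then L (e s.2) else e s.2),
      L x ∈ span ℝ (Set.range fun s : Bool × Fin j ↦ bif s.1 then L (e s.2) else e s.2) := by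
  intro x hx
  have h : (span ℝ (Set.range fun s : Bool × Fin j ↦ bif s.1 then L (e s.2) else e s.2)).map
      (L : F →ₗ[ℝ] F) ≤ span ℝ (Set.range fun s : Bool × Fin j ↦ bif s.1 then L (e s.2) else e s.2) := by
    rw [map_span_le]
    rintro _ ⟨⟨b, a⟩, rfl⟩
    cases b
    · exact subset_span ⟨(true, a), by simp⟩
    · simp only [cond_true, ContinuousLinearMap.coe_coe, hL]
      exact neg_mem (subset_span ⟨(false, a), by simp⟩)
  exact h ⟨x, hx, rfl⟩

/-- **Extension step.** If the adapted family `(e_a, L e_a)_{a < j}` is linearly independent and `v` is not in its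
span `U`, then the adapted family of `(e_0, …, e_{j−1}, v)` is again linearly independent: `U` is `L`-stable, so from
`a v + b Lv ∈ U` one gets `(a² + b²) v ∈ U`. [folklore] -/
private theorem linearIndependent_adapted_append [FiniteDimensional ℝ F] {L : F →L[ℝ] F} (hL : ∀ v, L (L v) = -v) {j : ℕ}
    {e : Fin j → F} (hli : LinearIndependent ℝ fun s : Bool × Fin j ↦ bif s.1 then L (e s.2) else e s.2) {v : F}
    (hv : v ∉ span ℝ (Set.range fun s : Bool × Fin j ↦ bif s.1 then L (e s.2) else e s.2)) :
    LinearIndependent ℝ fun s : Bool × Fin (j + 1) ↦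
      bif s.1 then L (Fin.append e ![v] s.2) else Fin.append e ![v] s.2 := by
  classical
  set U := span ℝ (Set.range fun s : Bool × Fin j ↦ bif s.1 then L (e s.2) else e s.2) with hU
  -- the key computation: `a v + b Lv ∈ U ⟹ a = 0 ∧ b = 0`
  have key : ∀ a b : ℝ, a • v + b • L v ∈ U → a = 0 ∧ b = 0 := by
    intro a b hab
    have hL' : a • L v - b • v ∈ U := by
      have := map_span_adapted_le hL e _ hab
      simpa [map_add, map_smul, hL, sub_eq_add_neg] using this
    have hsum : (a * a + b * b) • v ∈ U := by
      have : (a * a + b * b) • v = a • (a • v + b • L v) - b • (a • L v - b • v) := by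
        simp only [smul_add, smul_sub, smul_smul, add_smul]
        abel_nf
        simp only [mul_comm b a]
        abel
      rw [this]
      exact U.sub_mem (U.smul_mem a hab) (U.smul_mem b hL')
    by_contra hne
    have hpos : a * a + b * b ≠ 0 := by
      rcases not_and_or.mp hne with ha | hb
      · exact ne_of_gt (add_pos_of_pos_of_nonneg (mul_self_pos.mpr ha) (mul_self_nonneg b))
      · exact ne_of_gt (add_pos_of_nonneg_of_pos (mul_self_nonneg a) (mul_self_pos.mpr hb))
    exact hv (by simpa [hpos] using U.smul_mem (a * a + b * b)⁻¹ hsum)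
  -- reindex `Bool × Fin (j+1) ≃ (Bool × Fin j) ⊕ (Bool × Fin 1)`
  let E : (Bool × Fin j) ⊕ (Bool × Fin 1) ≃ Bool × Fin (j + 1) :=
    (Equiv.prodSumDistrib Bool (Fin j) (Fin 1)).symm.trans (Equiv.prodCongr (Equiv.refl Bool) finSumFinEquiv)
  rw [← linearIndependent_equiv E]
  have hcomp : (fun s : Bool × Fin (j + 1) ↦ bif s.1 then L (Fin.append e ![v] s.2) else Fin.append e ![v] s.2) ∘ E =
      Sum.elim (fun s : Bool × Fin j ↦ bif s.1 then L (e s.2) else e s.2)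
        (fun s : Bool × Fin 1 ↦ bif s.1 then L v else v) := by
    funext x
    rcases x with ⟨b, a⟩ | ⟨b, a⟩
    · simp [E, Fin.append_left]
    · have ha : a = 0 := Subsingleton.elim a 0
      subst ha
      simp [E, Fin.append_right]
  rw [hcomp, linearIndependent_sum]
  refine ⟨hli, ?_, ?_⟩
  · -- the pair `(v, Lv)` is independent
    rw [Fintype.linearIndependent_iff]
    intro g hg
    have hg' : g (false, 0) • v + g (true, 0) • L v = 0 := by
      simpa [Fintype.sum_prod_type, add_comm] using hg
    have h0 := key (g (false, 0)) (g (true, 0)) (by rw [hg']; exact U.zero_mem)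
    rintro ⟨b, a⟩
    have ha : a = 0 := Subsingleton.elim a 0
    subst ha
    cases b
    · exact h0.1
    · exact h0.2
  · -- the spans meet trivially
    rw [Submodule.disjoint_def]
    intro x hxU hx
    change x ∈ U at hxU
    obtain ⟨c, rfl⟩ := (Submodule.mem_span_range_iff_exists_fun ℝ).mp hx
    have hc : ∑ i, c i • ((Sum.elim (fun s : Bool × Fin j ↦ bif s.1 then L (e s.2) else e s.2)
        (fun s : Bool × Fin 1 ↦ bif s.1 then L v else v)) ∘ Sum.inr) i = c (false, 0) • v + c (true, 0) • L v := by
      simp [Fintype.sum_prod_type, add_comm]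
    rw [hc] at hxU ⊢
    obtain ⟨h1, h2⟩ := key _ _ hxU
    simp [h1, h2]

/-! ### §2 Adapted bases exist -/

/-- **Every complex structure `L` (`L² = −1`) of a finite-dimensional real space admits an adapted basis
`(e_a, L e_a)_{a < m}`** (indexed by `Bool × Fin m`: `(ff, a) ↦ e_a`, `(tt, a) ↦ L e_a`) — a maximal independent adapted
family spans, by the extension step. [cite: BuskinIzadi2020TwistorLinesTori, §1.1 p.5 L28–31 ("a complex structure
`I : V_ℝ → V_ℝ` corresponds to the `2n`-plane `(1 − iI)V_ℝ` … `Compl ≅ G/G_I`, where `G_I ≅ GL_{2n}(ℂ)`") and §1.2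
p.5 L46–p.6 L4 (block bases); folklore linear algebra] -/
theorem exists_adapted_basis [FiniteDimensional ℝ F] (L : F →L[ℝ] F) (hL : ∀ v, L (L v) = -v) :
    ∃ (m : ℕ) (e : Fin m → F) (r : Basis (Bool × Fin m) ℝ F),
      ∀ s, r s = bif s.1 then L (e s.2) else e s.2 := by
  classical
  let P : ℕ → Prop := fun j ↦ ∃ e : Fin j → F,
    LinearIndependent ℝ fun s : Bool × Fin j ↦ bif s.1 then L (e s.2) else e s.2
  have hP0 : P 0 := ⟨Fin.elim0, linearIndependent_empty_type⟩
  have hPbound : ∀ j, P j → 2 * j ≤ finrank ℝ F := fun j ⟨e, he⟩ ↦ by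
    have := he.fintype_card_le_finrank
    simpa [Fintype.card_prod, Fintype.card_bool, Fintype.card_fin] using this
  set m := Nat.findGreatest P (finrank ℝ F) with hm
  have hPm : P m := Nat.findGreatest_spec (Nat.zero_le _) hP0
  obtain ⟨e, he⟩ := hPm
  -- the family spans: otherwise extend it, contradicting maximality
  have hspan : span ℝ (Set.range fun s : Bool × Fin m ↦ bif s.1 then L (e s.2) else e s.2) = ⊤ := by
    by_contra hne
    obtain ⟨v, -, hv⟩ := SetLike.exists_of_lt (lt_top_iff_ne_top.mpr hne)
    have hP1 : P (m + 1) := ⟨Fin.append e ![v], linearIndependent_adapted_append hL he hv⟩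
    have hle : m + 1 ≤ finrank ℝ F := by have := hPbound _ hP1; omega
    exact Nat.findGreatest_is_greatest (Nat.lt_succ_self _) hle hP1
  exact ⟨m, e, Basis.mk he (by rw [hspan]), fun s ↦ by rw [Basis.coe_mk]⟩

/-- **A complex structure lives on an even-dimensional space**: `dim_ℝ F = 2m` for the size `m` of any adapted basis.
[cite: BuskinIzadi2020TwistorLinesTori, §1.1 p.5 L22–24 ("`dim_ℝ V_ℝ = 2 dim_ℂ V = 4n`")] -/
theorem finrank_eq_two_mul_of_adapted_basis {L : F →L[ℝ] F} {m : ℕ} {e : Fin m → F} (r : Basis (Bool × Fin m) ℝ F)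
    (_hr : ∀ s, r s = bif s.1 then L (e s.2) else e s.2) : finrank ℝ F = 2 * m := by
  rw [finrank_eq_card_basis r, Fintype.card_prod, Fintype.card_bool, Fintype.card_fin]

/-- **`dim_ℝ F` is even** as soon as `F` carries a complex structure. [cite: BuskinIzadi2020TwistorLinesTori, §1.1
p.5 L22–24] -/
theorem even_finrank_of_complexStructure [FiniteDimensional ℝ F] (L : F →L[ℝ] F) (hL : ∀ v, L (L v) = -v) :
    Even (finrank ℝ F) := by
  obtain ⟨m, e, r, hr⟩ := exists_adapted_basis L hL
  exact ⟨m, by rw [finrank_eq_two_mul_of_adapted_basis r hr, two_mul]⟩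

/-! ### §3 Any two complex structures are conjugate under `GL(V_ℝ)` -/

/-- **`G = GL(V_ℝ)` acts transitively on `Compl`**: any two complex structures `L₁, L₂` of a finite-dimensional real
space are conjugate by a linear automorphism, `g L₁ = L₂ g` (map an adapted basis of `L₁` to an adapted basis of `L₂`).
[cite: BuskinIzadi2020TwistorLinesTori, §1.1 p.5 L30–31 ("Compl is the orbit of `I` under the conjugation action of
`G := GL(V_ℝ)`: `Compl ≅ G/G_I`"), §1.3 p.6 L37–38 ("the group `G` acts transitively on it: `g ∈ G: J ↦ gJ = gJg⁻¹`")] -/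
theorem exists_conj_of_complexStructure [FiniteDimensional ℝ F] (L₁ L₂ : F →L[ℝ] F) (h₁ : ∀ v, L₁ (L₁ v) = -v)
    (h₂ : ∀ v, L₂ (L₂ v) = -v) : ∃ g : F ≃L[ℝ] F, ∀ v, g (L₁ v) = L₂ (g v) := by
  classical
  obtain ⟨m₁, e₁, r₁, hr₁⟩ := exists_adapted_basis L₁ h₁
  obtain ⟨m₂, e₂, r₂, hr₂⟩ := exists_adapted_basis L₂ h₂
  have hm : m₁ = m₂ := by
    have := (finrank_eq_two_mul_of_adapted_basis r₁ hr₁).symm.trans (finrank_eq_two_mul_of_adapted_basis r₂ hr₂)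
    omega
  subst hm
  let g : F ≃ₗ[ℝ] F := r₁.equiv r₂ (Equiv.refl _)
  have hg : ∀ s, g (r₁ s) = r₂ s := fun s ↦ by simp [g]
  refine ⟨g.toContinuousLinearEquiv, fun v ↦ ?_⟩
  -- check on the adapted basis of `L₁`
  have key : (g.toLinearMap ∘ₗ (L₁ : F →ₗ[ℝ] F)) = ((L₂ : F →ₗ[ℝ] F) ∘ₗ g.toLinearMap) := by
    refine r₁.ext fun s ↦ ?_
    obtain ⟨b, a⟩ := s
    cases b
    · -- `e_a ↦ L₁ e_a = r₁ (tt, a)`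
      have e1 : L₁ (r₁ (false, a)) = r₁ (true, a) := by rw [hr₁, hr₁]; rfl
      have e2 : L₂ (r₂ (false, a)) = r₂ (true, a) := by rw [hr₂, hr₂]; rfl
      simp only [LinearMap.coe_comp, Function.comp_apply, ContinuousLinearMap.coe_coe, LinearEquiv.coe_coe, e1, hg, e2]
    · -- `L₁ e_a ↦ −e_a`
      have e1 : L₁ (r₁ (true, a)) = -r₁ (false, a) := by rw [hr₁, hr₁]; simp [h₁]
      have e2 : L₂ (r₂ (true, a)) = -r₂ (false, a) := by rw [hr₂, hr₂]; simp [h₂]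
      simp only [LinearMap.coe_comp, Function.comp_apply, ContinuousLinearMap.coe_coe, LinearEquiv.coe_coe, e1,
        map_neg, hg, e2]
  have := LinearMap.congr_fun key v
  simpa using this

/-! ### §4 Every complex structure of a `4n`-dimensional space has an anticommuting partner -/

/-- **Anticommuting partners exist in real dimension `4n`**: for a complex structure `L` of a real space of dimension
`4n` there is a complex structure `J` with `JL = −LJ` — on an adapted basis `(e_a, L e_a)` with the `e`'s split in two
halves `e_a, e'_a` (`a < n`), `J e_a = e'_a`, `J e'_a = −e_a`, `J L e_a = −L e'_a`, `J L e'_a = L e_a` (the block form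
`⟨v, Iv, Jv, IJv⟩` of §1.2); so `L` "determines twistor spheres `S(L, J)`". [cite: BuskinIzadi2020TwistorLinesTori,
§1.1 p.5 L36–38 ("Assume that `J : V_ℝ → V_ℝ` is a complex structure anticommuting with `I`. Then `I` and `J`
determine a twistor sphere `S(I, J) := {aI + bJ + cK | a² + b² + c² = 1}`"), §1.2 p.5 L46–p.6 L28, §1.4 Cor. 1.4
p.6 L55 ("The set `N_I` is a real submanifold of `Compl` of dimension `4n²`")] -/
theorem exists_anticommuting_complexStructure [FiniteDimensional ℝ F] {n : ℕ} (hF : finrank ℝ F = 4 * n)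
    (L : F →L[ℝ] F) (hL : ∀ v, L (L v) = -v) :
    ∃ J : F →L[ℝ] F, (∀ v, J (J v) = -v) ∧ ∀ v, J (L v) = -L (J v) := by
  classical
  obtain ⟨m, e, r, hr⟩ := exists_adapted_basis L hL
  have hm : m = 2 * n := by have := finrank_eq_two_mul_of_adapted_basis r hr; omega
  subst hm
  -- split the `e`-index `Fin (2n)` as `Bool × Fin n` (`c = ff`: first half `e_a`; `c = tt`: second half `e'_a`)
  let ix : Bool × Fin n ≃ Fin (2 * n) := (finTwoEquiv.symm.prodCongr (Equiv.refl _)).trans finProdFinEquiv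
  let r' : Basis (Bool × (Bool × Fin n)) ℝ F := r.reindex ((Equiv.refl Bool).prodCongr ix).symm
  have hr' : ∀ b c a, r' (b, (c, a)) = bif b then L (e (ix (c, a))) else e (ix (c, a)) := fun b c a ↦ by
    simp only [r', Basis.reindex_apply, Equiv.symm_symm, Equiv.prodCongr_apply, Equiv.coe_refl, Prod.map_apply,
      id_eq, hr]
  -- images of the basis vectors under `J`
  let f : Bool × (Bool × Fin n) → F := fun s ↦
    match s with
    | (false, (false, a)) => r' (false, (true, a))      -- `J e_a = e'_a`
    | (false, (true, a)) => -r' (false, (false, a))     -- `J e'_a = −e_a`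
    | (true, (false, a)) => -r' (true, (true, a))       -- `J L e_a = −L e'_a`
    | (true, (true, a)) => r' (true, (false, a))        -- `J L e'_a = L e_a`
  let J : F →L[ℝ] F := LinearMap.toContinuousLinearMap (r'.constr ℝ f)
  have hJ : ∀ s, J (r' s) = f s := fun s ↦ by
    simp only [J, LinearMap.coe_toContinuousLinearMap', Basis.constr_basis]
  have hLr : ∀ c a, L (r' (false, (c, a))) = r' (true, (c, a)) := fun c a ↦ by rw [hr', hr']; rfl
  have hLr' : ∀ c a, L (r' (true, (c, a))) = -r' (false, (c, a)) := fun c a ↦ by rw [hr', hr']; simp [hL]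
  -- `J² = −1` and `JL = −LJ` on the basis
  have hJJ : ∀ s, J (J (r' s)) = -r' s := by
    rintro ⟨b, c, a⟩
    cases b <;> cases c <;> simp only [hJ, f, map_neg]
  have hJL : ∀ s, J (L (r' s)) = -L (J (r' s)) := by
    rintro ⟨b, c, a⟩
    cases b <;> cases c <;> simp only [hJ, f, hLr, hLr', map_neg, neg_neg]
  refine ⟨J, fun v ↦ ?_, fun v ↦ ?_⟩
  · have key : ((J : F →ₗ[ℝ] F) ∘ₗ (J : F →ₗ[ℝ] F)) = -LinearMap.id := r'.ext fun s ↦ by simpa using hJJ s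
    simpa using LinearMap.congr_fun key v
  · have key : ((J : F →ₗ[ℝ] F) ∘ₗ (L : F →ₗ[ℝ] F)) = -((L : F →ₗ[ℝ] F) ∘ₗ (J : F →ₗ[ℝ] F)) :=
      r'.ext fun s ↦ by simpa using hJL s
    simpa using LinearMap.congr_fun key v

/-! ### §5 A compatible metric (Buskin–Izadi Prop. 1.2): average any inner product over `{1, L, J, LJ}` -/

/-- **An inner product exists on every finite-dimensional real normed space** (coordinates of a basis):
`g₁(x, y) = Σ_s x_s y_s`, symmetric and positive definite, as a continuous bilinear map. [folklore] -/
private theorem exists_inner_aux [FiniteDimensional ℝ F] :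
    ∃ g₁ : F →L[ℝ] F →L[ℝ] ℝ, (∀ x y, g₁ x y = g₁ y x) ∧ (∀ x, 0 ≤ g₁ x x) ∧ ∀ x, x ≠ 0 → 0 < g₁ x x := by
  classical
  let b := Module.finBasis ℝ F
  let f : F → F → ℝ := fun v w ↦ ∑ k, b.repr v k * b.repr w k
  have hz_add : ∀ v w k, b.repr (v + w) k = b.repr v k + b.repr w k := fun v w k ↦ by
    rw [map_add, Finsupp.add_apply]
  have hz_smul : ∀ (r : ℝ) v k, b.repr (r • v) k = r * b.repr v k := fun r v k ↦ by
    rw [map_smul, Finsupp.smul_apply, smul_eq_mul]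
  have hf1 : ∀ v₁ v₂ w, f (v₁ + v₂) w = f v₁ w + f v₂ w := fun v₁ v₂ w ↦ by
    simp only [f, hz_add, add_mul, Finset.sum_add_distrib]
  have hf2 : ∀ (r : ℝ) v w, f (r • v) w = r • f v w := fun r v w ↦ by
    simp only [f, hz_smul, smul_eq_mul, Finset.mul_sum, mul_assoc]
  have hf3 : ∀ v w₁ w₂, f v (w₁ + w₂) = f v w₁ + f v w₂ := fun v w₁ w₂ ↦ by
    simp only [f, hz_add, mul_add, Finset.sum_add_distrib]
  have hf4 : ∀ (r : ℝ) v w, f v (r • w) = r • f v w := fun r v w ↦ by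
    simp only [f, hz_smul, smul_eq_mul, Finset.mul_sum]
    exact Finset.sum_congr rfl fun k _ ↦ by ring
  let g₁ : F →L[ℝ] F →L[ℝ] ℝ := LinearMap.toContinuousLinearMap
    ((LinearMap.toContinuousLinearMap : (F →ₗ[ℝ] ℝ) ≃ₗ[ℝ] (F →L[ℝ] ℝ)).toLinearMap ∘ₗ LinearMap.mk₂ ℝ f hf1 hf2 hf3 hf4)
  have hg : ∀ v w, g₁ v w = f v w := fun v w ↦ rfl
  refine ⟨g₁, fun x y ↦ ?_, fun x ↦ ?_, fun x hx ↦ ?_⟩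
  · rw [hg, hg]; exact Finset.sum_congr rfl fun k _ ↦ mul_comm _ _
  · rw [hg]; exact Finset.sum_nonneg fun k _ ↦ mul_self_nonneg _
  · rw [hg]
    have hne : b.repr x ≠ 0 := fun h ↦ hx (b.repr.map_eq_zero_iff.mp h)
    obtain ⟨k, hk⟩ : ∃ k, b.repr x k ≠ 0 := by
      by_contra h
      push Not at h
      exact hne (Finsupp.ext h)
    exact lt_of_lt_of_le (mul_self_pos.mpr hk)
      (Finset.single_le_sum (fun k _ ↦ mul_self_nonneg (b.repr x k)) (Finset.mem_univ k))

/-- **A hyperkähler metric for every quaternionic pair (Buskin–Izadi Prop. 1.2, linear form).** For complex structures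
`L, J` with `JL = −LJ` on a finite-dimensional real space there is a symmetric positive definite bilinear form `g`
invariant under `L` and `J` (hence under `K = LJ`): average any inner product over the group `{1, L, J, LJ}` (the
printed proof instead declares an adapted block basis `⟨v, Iv, Jv, IJv⟩` orthonormal; the tree's
`exists_isLinearHyperkaehler_of_anticommuting` is the same averaging on a complex carrier).
[cite: BuskinIzadi2020TwistorLinesTori, §1.2 Prop. 1.2 (p.6 L29–34: "Given a triple of complex structures (I, J, K) on A
satisfying the quaternionic identities, there exist a (non-unique) metric g on A such that (I, J, K) is a hyperkähler
structure with respect to g")] -/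
theorem exists_invariant_inner [FiniteDimensional ℝ F] (L J : F →L[ℝ] F) (hL : ∀ v, L (L v) = -v)
    (hJ : ∀ v, J (J v) = -v) (hLJ : ∀ v, J (L v) = -L (J v)) :
    ∃ g : F →L[ℝ] F →L[ℝ] ℝ, (∀ x y, g x y = g y x) ∧ (∀ x, x ≠ 0 → 0 < g x x) ∧
      (∀ x y, g (L x) (L y) = g x y) ∧ ∀ x y, g (J x) (J y) = g x y := by
  obtain ⟨g₁, hsymm, hnonneg, hpos⟩ := exists_inner_aux (F := F)
  -- `(x, y) ↦ g₁ (q x) (q y)` as a continuous bilinear map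
  let pull : (F →L[ℝ] F) → (F →L[ℝ] F →L[ℝ] ℝ) := fun q ↦ ((g₁.comp q).flip.comp q).flip
  have hpull : ∀ q x y, pull q x y = g₁ (q x) (q y) := fun q x y ↦ rfl
  let g : F →L[ℝ] F →L[ℝ] ℝ := g₁ + pull L + pull J + pull (L.comp J)
  have hg : ∀ x y, g x y = g₁ x y + g₁ (L x) (L y) + g₁ (J x) (J y) + g₁ (L (J x)) (L (J y)) := fun x y ↦ by
    simp only [g, add_apply, hpull, ContinuousLinearMap.coe_comp, Function.comp_apply]
  have hneg : ∀ x y, g₁ (-x) (-y) = g₁ x y := fun x y ↦ by simp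
  refine ⟨g, fun x y ↦ ?_, fun x hx ↦ ?_, fun x y ↦ ?_, fun x y ↦ ?_⟩
  · rw [hg, hg, hsymm x y, hsymm (L x), hsymm (J x), hsymm (L (J x))]
  · rw [hg]
    have := hpos x hx
    have := hnonneg (L x)
    have := hnonneg (J x)
    have := hnonneg (L (J x))
    linarith
  · rw [hg, hg]
    simp only [hL, hLJ, map_neg, neg_apply, neg_neg]
    ring
  · rw [hg, hg]
    simp only [hJ, map_neg, neg_apply, neg_neg]
    ring

/-- **Every complex structure of a `4n`-dimensional real space is part of a linear hyperkähler structure `(L, J, g)`**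
(§4 + Prop. 1.2): so, on a complex torus of even complex dimension, EVERY complex structure is "compatible with some
hyperkähler structure". [cite: BuskinIzadi2020TwistorLinesTori, §1.2 (p.5 L46–p.6 L28) with Prop. 1.2 (p.6 L29–34)] -/
theorem exists_hyperkaehler_of_finrank_eq [FiniteDimensional ℝ F] {n : ℕ} (hF : finrank ℝ F = 4 * n)
    (L : F →L[ℝ] F) (hL : ∀ v, L (L v) = -v) :
    ∃ (J : F →L[ℝ] F) (g : F →L[ℝ] F →L[ℝ] ℝ), (∀ v, J (J v) = -v) ∧ (∀ v, J (L v) = -L (J v)) ∧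
      (∀ x y, g x y = g y x) ∧ (∀ x, x ≠ 0 → 0 < g x x) ∧ (∀ x y, g (L x) (L y) = g x y) ∧
      ∀ x y, g (J x) (J y) = g x y := by
  obtain ⟨J, hJ, hLJ⟩ := exists_anticommuting_complexStructure hF L hL
  obtain ⟨g, h1, h2, h3, h4⟩ := exists_invariant_inner L J hL hJ hLJ
  exact ⟨J, g, hJ, hLJ, h1, h2, h3, h4⟩

/-! ### §6 The simultaneous block basis `⟨v, Lv, Jv, LJv⟩` of a quaternionic pair (Buskin–Izadi §1.2) -/

section Pair

variable {L J : F →L[ℝ] F}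

/-- The span of a pair-adapted family `(e_a, L e_a, J e_a, LJ e_a)_a` is `L`-stable. [folklore] -/
private theorem map_span_pairAdapted_L (hL : ∀ v, L (L v) = -v) {j : ℕ} (e : Fin j → F) :
    ∀ x ∈ span ℝ (Set.range fun s : (Bool × Bool) × Fin j ↦
        bif s.1.1 then L (bif s.1.2 then J (e s.2) else e s.2) else (bif s.1.2 then J (e s.2) else e s.2)),
      L x ∈ span ℝ (Set.range fun s : (Bool × Bool) × Fin j ↦
        bif s.1.1 then L (bif s.1.2 then J (e s.2) else e s.2) else (bif s.1.2 then J (e s.2) else e s.2)) := by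
  intro x hx
  have h : (span ℝ (Set.range fun s : (Bool × Bool) × Fin j ↦
      bif s.1.1 then L (bif s.1.2 then J (e s.2) else e s.2) else (bif s.1.2 then J (e s.2) else e s.2))).map
      (L : F →ₗ[ℝ] F) ≤ span ℝ (Set.range fun s : (Bool × Bool) × Fin j ↦
        bif s.1.1 then L (bif s.1.2 then J (e s.2) else e s.2) else (bif s.1.2 then J (e s.2) else e s.2)) := by
    rw [map_span_le]
    rintro _ ⟨⟨⟨b, c⟩, a⟩, rfl⟩
    cases b
    · exact subset_span ⟨((true, c), a), by simp⟩
    · simp only [cond_true, ContinuousLinearMap.coe_coe, hL]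
      exact neg_mem (subset_span ⟨((false, c), a), by simp⟩)
  exact h ⟨x, hx, rfl⟩

/-- The span of a pair-adapted family is `J`-stable (`JL = −LJ`, so `J` permutes the four block vectors up to sign).
[folklore] -/
private theorem map_span_pairAdapted_J (hL : ∀ v, L (L v) = -v) (hJ : ∀ v, J (J v) = -v)
    (hLJ : ∀ v, J (L v) = -L (J v)) {j : ℕ} (e : Fin j → F) :
    ∀ x ∈ span ℝ (Set.range fun s : (Bool × Bool) × Fin j ↦
        bif s.1.1 then L (bif s.1.2 then J (e s.2) else e s.2) else (bif s.1.2 then J (e s.2) else e s.2)),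
      J x ∈ span ℝ (Set.range fun s : (Bool × Bool) × Fin j ↦
        bif s.1.1 then L (bif s.1.2 then J (e s.2) else e s.2) else (bif s.1.2 then J (e s.2) else e s.2)) := by
  intro x hx
  have h : (span ℝ (Set.range fun s : (Bool × Bool) × Fin j ↦
      bif s.1.1 then L (bif s.1.2 then J (e s.2) else e s.2) else (bif s.1.2 then J (e s.2) else e s.2))).map
      (J : F →ₗ[ℝ] F) ≤ span ℝ (Set.range fun s : (Bool × Bool) × Fin j ↦
        bif s.1.1 then L (bif s.1.2 then J (e s.2) else e s.2) else (bif s.1.2 then J (e s.2) else e s.2)) := by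
    rw [map_span_le]
    rintro _ ⟨⟨⟨b, c⟩, a⟩, rfl⟩
    cases b <;> cases c
    · exact subset_span ⟨((false, true), a), by simp⟩
    · simp only [cond_true, cond_false, ContinuousLinearMap.coe_coe, hJ]
      exact neg_mem (subset_span ⟨((false, false), a), by simp⟩)
    · simp only [cond_true, cond_false, ContinuousLinearMap.coe_coe, hLJ]
      exact neg_mem (subset_span ⟨((true, true), a), by simp⟩)
    · simp only [cond_true, ContinuousLinearMap.coe_coe, hLJ, hJ, map_neg, neg_neg]
      exact subset_span ⟨((true, false), a), by simp⟩
  have hL' := hL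
  exact h ⟨x, hx, rfl⟩

/-- **Extension step for a pair**: if the pair-adapted family of `(e_a)_{a<j}` is linearly independent and `v` is not in
its span `U`, the pair-adapted family of `(e_0, …, e_{j−1}, v)` is linearly independent — from
`w = a v + b Lv + c Jv + d LJv ∈ U` and the `L`-, `J`-stability of `U` one gets `(a² + b² + c² + d²) v =
a w − b Lw − c Jw − d LJw ∈ U`. [folklore] -/
private theorem linearIndependent_pairAdapted_append [FiniteDimensional ℝ F] (hL : ∀ v, L (L v) = -v)
    (hJ : ∀ v, J (J v) = -v) (hLJ : ∀ v, J (L v) = -L (J v)) {j : ℕ} {e : Fin j → F}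
    (hli : LinearIndependent ℝ fun s : (Bool × Bool) × Fin j ↦
      bif s.1.1 then L (bif s.1.2 then J (e s.2) else e s.2) else (bif s.1.2 then J (e s.2) else e s.2)) {v : F}
    (hv : v ∉ span ℝ (Set.range fun s : (Bool × Bool) × Fin j ↦
      bif s.1.1 then L (bif s.1.2 then J (e s.2) else e s.2) else (bif s.1.2 then J (e s.2) else e s.2))) :
    LinearIndependent ℝ fun s : (Bool × Bool) × Fin (j + 1) ↦
      bif s.1.1 then L (bif s.1.2 then J (Fin.append e ![v] s.2) else Fin.append e ![v] s.2)
      else (bif s.1.2 then J (Fin.append e ![v] s.2) else Fin.append e ![v] s.2) := by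
  classical
  set U := span ℝ (Set.range fun s : (Bool × Bool) × Fin j ↦
    bif s.1.1 then L (bif s.1.2 then J (e s.2) else e s.2) else (bif s.1.2 then J (e s.2) else e s.2)) with hU
  -- key computation
  have key : ∀ a b c d : ℝ, a • v + b • L v + c • J v + d • L (J v) ∈ U → a = 0 ∧ b = 0 ∧ c = 0 ∧ d = 0 := by
    intro a b c d hw
    have hLw : a • L v - b • v + c • L (J v) - d • J v ∈ U := by
      have := map_span_pairAdapted_L hL e _ hw
      simpa [map_add, map_smul, hL, sub_eq_add_neg] using this
    have hJw : a • J v - b • L (J v) - c • v + d • L v ∈ U := by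
      have := map_span_pairAdapted_J hL hJ hLJ e _ hw
      simpa [map_add, map_smul, hJ, hLJ, sub_eq_add_neg] using this
    have hLJw : a • L (J v) + b • J v - c • L v - d • v ∈ U := by
      have := map_span_pairAdapted_L hL e _ hJw
      simpa [map_add, map_sub, map_smul, hL, sub_eq_add_neg] using this
    have hsum : (a * a + b * b + c * c + d * d) • v ∈ U := by
      have : (a * a + b * b + c * c + d * d) • v =
          a • (a • v + b • L v + c • J v + d • L (J v)) - b • (a • L v - b • v + c • L (J v) - d • J v)
          - c • (a • J v - b • L (J v) - c • v + d • L v) - d • (a • L (J v) + b • J v - c • L v - d • v) := by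
        module
      rw [this]
      exact U.sub_mem (U.sub_mem (U.sub_mem (U.smul_mem a hw) (U.smul_mem b hLw)) (U.smul_mem c hJw))
        (U.smul_mem d hLJw)
    by_contra hne
    have hpos : a * a + b * b + c * c + d * d ≠ 0 := by
      have h4 : ¬(a = 0 ∧ b = 0 ∧ c = 0 ∧ d = 0) := hne
      intro h0
      apply h4
      have ha := mul_self_nonneg a
      have hb := mul_self_nonneg b
      have hc := mul_self_nonneg c
      have hd := mul_self_nonneg d
      refine ⟨?_, ?_, ?_, ?_⟩ <;> nlinarith [mul_self_eq_zero.mp (show a * a = 0 by linarith),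
        mul_self_eq_zero.mp (show b * b = 0 by linarith), mul_self_eq_zero.mp (show c * c = 0 by linarith),
        mul_self_eq_zero.mp (show d * d = 0 by linarith)]
    exact hv (by simpa [hpos] using U.smul_mem (a * a + b * b + c * c + d * d)⁻¹ hsum)
  -- reindex
  let E : ((Bool × Bool) × Fin j) ⊕ ((Bool × Bool) × Fin 1) ≃ (Bool × Bool) × Fin (j + 1) :=
    (Equiv.prodSumDistrib (Bool × Bool) (Fin j) (Fin 1)).symm.trans
      (Equiv.prodCongr (Equiv.refl (Bool × Bool)) finSumFinEquiv)
  rw [← linearIndependent_equiv E]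
  have hcomp : (fun s : (Bool × Bool) × Fin (j + 1) ↦
      bif s.1.1 then L (bif s.1.2 then J (Fin.append e ![v] s.2) else Fin.append e ![v] s.2)
      else (bif s.1.2 then J (Fin.append e ![v] s.2) else Fin.append e ![v] s.2)) ∘ E =
      Sum.elim (fun s : (Bool × Bool) × Fin j ↦
        bif s.1.1 then L (bif s.1.2 then J (e s.2) else e s.2) else (bif s.1.2 then J (e s.2) else e s.2))
        (fun s : (Bool × Bool) × Fin 1 ↦ bif s.1.1 then L (bif s.1.2 then J v else v) else (bif s.1.2 then J v else v)) := by
    funext x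
    rcases x with ⟨bc, a⟩ | ⟨bc, a⟩
    · simp [E, Fin.append_left]
    · have ha : a = 0 := Subsingleton.elim a 0
      subst ha
      simp [E, Fin.append_right]
  rw [hcomp, linearIndependent_sum]
  have hsum4 : ∀ g : (Bool × Bool) × Fin 1 → ℝ,
      ∑ i, g i • (fun s : (Bool × Bool) × Fin 1 ↦
        bif s.1.1 then L (bif s.1.2 then J v else v) else (bif s.1.2 then J v else v)) i =
      g ((false, false), 0) • v + g ((true, false), 0) • L v + g ((false, true), 0) • J v +
        g ((true, true), 0) • L (J v) := by
    intro g
    simp only [Fintype.sum_prod_type, Fintype.sum_bool, Finset.univ_unique, Fin.default_eq_zero,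
      Finset.sum_singleton, cond_true, cond_false]
    abel
  refine ⟨hli, ?_, ?_⟩
  · rw [Fintype.linearIndependent_iff]
    intro g hg
    simp only [Sum.elim_comp_inr] at hg
    rw [hsum4] at hg
    obtain ⟨h1, h2, h3, h4⟩ := key _ _ _ _ (by rw [hg]; exact U.zero_mem)
    rintro ⟨⟨b, c⟩, a⟩
    have ha : a = 0 := Subsingleton.elim a 0
    subst ha
    cases b <;> cases c
    · exact h1
    · exact h3
    · exact h2
    · exact h4
  · rw [Submodule.disjoint_def]
    intro x hxU hx
    change x ∈ U at hxU
    obtain ⟨g, rfl⟩ := (Submodule.mem_span_range_iff_exists_fun ℝ).mp hx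
    have hc := hsum4 g
    simp only [Sum.elim_comp_inr] at hxU ⊢
    rw [hc] at hxU ⊢
    obtain ⟨h1, h2, h3, h4⟩ := key _ _ _ _ hxU
    simp [h1, h2, h3, h4]

/-- **The block basis of a quaternionic pair (Buskin–Izadi §1.2).** For complex structures `L, J` with `JL = −LJ` on a
finite-dimensional real space there are vectors `e_0, …, e_{m−1}` such that `(e_a, L e_a, J e_a, LJ e_a)_{a<m}` is a
basis (indexed by `(Bool × Bool) × Fin m`: `((b₁, b₂), a) ↦ L^{b₁} J^{b₂} e_a`) — "V_ℝ splits … as a direct sum of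
4-dimensional subspaces of the form `⟨v, Iv, Jv, IJv⟩` … and the union of the specified bases of the 4-subspaces
forms a basis of `V_ℝ`". [cite: BuskinIzadi2020TwistorLinesTori, §1.2 p.5 L46–p.6 L4] -/
theorem exists_pairAdapted_basis [FiniteDimensional ℝ F] (L J : F →L[ℝ] F) (hL : ∀ v, L (L v) = -v)
    (hJ : ∀ v, J (J v) = -v) (hLJ : ∀ v, J (L v) = -L (J v)) :
    ∃ (m : ℕ) (e : Fin m → F) (r : Basis ((Bool × Bool) × Fin m) ℝ F),
      ∀ s, r s = bif s.1.1 then L (bif s.1.2 then J (e s.2) else e s.2) else (bif s.1.2 then J (e s.2) else e s.2) := by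
  classical
  let P : ℕ → Prop := fun j ↦ ∃ e : Fin j → F, LinearIndependent ℝ fun s : (Bool × Bool) × Fin j ↦
    bif s.1.1 then L (bif s.1.2 then J (e s.2) else e s.2) else (bif s.1.2 then J (e s.2) else e s.2)
  have hP0 : P 0 := ⟨Fin.elim0, linearIndependent_empty_type⟩
  have hPbound : ∀ j, P j → 4 * j ≤ finrank ℝ F := fun j ⟨e, he⟩ ↦ by
    have := he.fintype_card_le_finrank
    simp only [Fintype.card_prod, Fintype.card_bool, Fintype.card_fin] at this
    omega
  set m := Nat.findGreatest P (finrank ℝ F) with hm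
  have hPm : P m := Nat.findGreatest_spec (Nat.zero_le _) hP0
  obtain ⟨e, he⟩ := hPm
  have hspan : span ℝ (Set.range fun s : (Bool × Bool) × Fin m ↦
      bif s.1.1 then L (bif s.1.2 then J (e s.2) else e s.2) else (bif s.1.2 then J (e s.2) else e s.2)) = ⊤ := by
    by_contra hne
    obtain ⟨v, -, hv⟩ := SetLike.exists_of_lt (lt_top_iff_ne_top.mpr hne)
    have hP1 : P (m + 1) := ⟨Fin.append e ![v], linearIndependent_pairAdapted_append hL hJ hLJ he hv⟩
    have hle : m + 1 ≤ finrank ℝ F := by have := hPbound _ hP1; omega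
    exact Nat.findGreatest_is_greatest (Nat.lt_succ_self _) hle hP1
  exact ⟨m, e, Basis.mk he (by rw [hspan]), fun s ↦ by rw [Basis.coe_mk]⟩

/-- A quaternionic pair lives in real dimension `4m`. [cite: BuskinIzadi2020TwistorLinesTori, §1.1 p.5 L22–24
("`dim_ℝ V_ℝ = 2 dim_ℂ V = 4n`"), §1.2 p.5 L46–p.6 L4] -/
theorem finrank_eq_four_mul_of_pair [FiniteDimensional ℝ F] (L J : F →L[ℝ] F) (hL : ∀ v, L (L v) = -v)
    (hJ : ∀ v, J (J v) = -v) (hLJ : ∀ v, J (L v) = -L (J v)) : ∃ m, finrank ℝ F = 4 * m := by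
  obtain ⟨m, e, r, -⟩ := exists_pairAdapted_basis L J hL hJ hLJ
  exact ⟨m, by rw [finrank_eq_card_basis r, Fintype.card_prod, Fintype.card_prod, Fintype.card_bool,
    Fintype.card_fin]⟩

/-! ### §7 `GL(V_ℝ)` is transitive on quaternionic pairs (Lemma 4.1) and `G_I` on the complex structures
anticommuting with `I` (Prop. 1.3) -/

/-- **Lemma 4.1 (linear form): `G = GL(V_ℝ)` acts transitively on twistor spheres** — for two quaternionic pairs
`(L₁, J₁)`, `(L₂, J₂)` (`J_i L_i = −L_i J_i`) on the same finite-dimensional real space there is a linear automorphism `g`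
with `g L₁ = L₂ g` and `g J₁ = J₂ g` (map the block basis of `(L₁, J₁)` to that of `(L₂, J₂)`; both have the size
`dim_ℝ F / 4`), hence `g S(L₁, J₁) g⁻¹ = S(L₂, J₂)`. [cite: BuskinIzadi2020TwistorLinesTori, §4 Lemma 4.1 (p.21 L32–37:
"The group G = GL(V_ℝ) acts transitively on the set of twistor lines in Compl. Proof. Given two twistor spheres
S₁ = S(I₁, J₁) and S₂ = S(I₂, J₂), there is an element g ∈ G sending I₁ to I₂ …")] -/
theorem exists_conj_of_pair [FiniteDimensional ℝ F] (L₁ J₁ L₂ J₂ : F →L[ℝ] F) (hL₁ : ∀ v, L₁ (L₁ v) = -v)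
    (hJ₁ : ∀ v, J₁ (J₁ v) = -v) (hLJ₁ : ∀ v, J₁ (L₁ v) = -L₁ (J₁ v)) (hL₂ : ∀ v, L₂ (L₂ v) = -v)
    (hJ₂ : ∀ v, J₂ (J₂ v) = -v) (hLJ₂ : ∀ v, J₂ (L₂ v) = -L₂ (J₂ v)) :
    ∃ g : F ≃L[ℝ] F, (∀ v, g (L₁ v) = L₂ (g v)) ∧ ∀ v, g (J₁ v) = J₂ (g v) := by
  classical
  obtain ⟨m, e, r, hr⟩ := exists_pairAdapted_basis L₁ J₁ hL₁ hJ₁ hLJ₁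
  obtain ⟨m', e', r', hr'⟩ := exists_pairAdapted_basis L₂ J₂ hL₂ hJ₂ hLJ₂
  have hm : m = m' := by
    have h1 : finrank ℝ F = 4 * m := by
      rw [finrank_eq_card_basis r, Fintype.card_prod, Fintype.card_prod, Fintype.card_bool, Fintype.card_fin]
    have h2 : finrank ℝ F = 4 * m' := by
      rw [finrank_eq_card_basis r', Fintype.card_prod, Fintype.card_prod, Fintype.card_bool, Fintype.card_fin]
    omega
  subst hm
  let g : F ≃ₗ[ℝ] F := r.equiv r' (Equiv.refl _)
  have hg : ∀ s, g (r s) = r' s := fun s ↦ by simp [g]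
  -- the actions of `L_i`, `J_i` on their block bases have the same shape
  have hLr : ∀ (rr : Basis ((Bool × Bool) × Fin m) ℝ F) (LL JJ : F →L[ℝ] F) (ee : Fin m → F),
      (∀ v, LL (LL v) = -v) →
      (∀ s, rr s = bif s.1.1 then LL (bif s.1.2 then JJ (ee s.2) else ee s.2) else (bif s.1.2 then JJ (ee s.2) else ee s.2)) →
      ∀ c a, LL (rr ((false, c), a)) = rr ((true, c), a) ∧ LL (rr ((true, c), a)) = -rr ((false, c), a) := by
    intro rr LL JJ ee hLL hrr c a
    refine ⟨by rw [hrr, hrr]; rfl, by rw [hrr, hrr]; simp [hLL]⟩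
  have hJr : ∀ (rr : Basis ((Bool × Bool) × Fin m) ℝ F) (LL JJ : F →L[ℝ] F) (ee : Fin m → F),
      (∀ v, JJ (JJ v) = -v) → (∀ v, JJ (LL v) = -LL (JJ v)) →
      (∀ s, rr s = bif s.1.1 then LL (bif s.1.2 then JJ (ee s.2) else ee s.2) else (bif s.1.2 then JJ (ee s.2) else ee s.2)) →
      ∀ a, JJ (rr ((false, false), a)) = rr ((false, true), a) ∧ JJ (rr ((false, true), a)) = -rr ((false, false), a) ∧
        JJ (rr ((true, false), a)) = -rr ((true, true), a) ∧ JJ (rr ((true, true), a)) = rr ((true, false), a) := by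
    intro rr LL JJ ee hJJ hLJJ hrr a
    refine ⟨by rw [hrr, hrr]; rfl, by rw [hrr, hrr]; simp [hJJ], by rw [hrr, hrr]; simp [hLJJ],
      by rw [hrr, hrr]; simp [hLJJ, hJJ]⟩
  refine ⟨g.toContinuousLinearEquiv, fun v ↦ ?_, fun v ↦ ?_⟩
  · have key : (g.toLinearMap ∘ₗ (L₁ : F →ₗ[ℝ] F)) = ((L₂ : F →ₗ[ℝ] F) ∘ₗ g.toLinearMap) := by
      refine r.ext fun s ↦ ?_
      obtain ⟨⟨b, c⟩, a⟩ := s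
      obtain ⟨h1, h2⟩ := hLr r L₁ J₁ e hL₁ hr c a
      obtain ⟨h1', h2'⟩ := hLr r' L₂ J₂ e' hL₂ hr' c a
      cases b
      · simp only [LinearMap.coe_comp, Function.comp_apply, ContinuousLinearMap.coe_coe, LinearEquiv.coe_coe, h1, hg, h1']
      · simp only [LinearMap.coe_comp, Function.comp_apply, ContinuousLinearMap.coe_coe, LinearEquiv.coe_coe, h2,
          map_neg, hg, h2']
    have := LinearMap.congr_fun key v
    simpa using this
  · have key : (g.toLinearMap ∘ₗ (J₁ : F →ₗ[ℝ] F)) = ((J₂ : F →ₗ[ℝ] F) ∘ₗ g.toLinearMap) := by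
      refine r.ext fun s ↦ ?_
      obtain ⟨⟨b, c⟩, a⟩ := s
      obtain ⟨h1, h2, h3, h4⟩ := hJr r L₁ J₁ e hJ₁ hLJ₁ hr a
      obtain ⟨h1', h2', h3', h4'⟩ := hJr r' L₂ J₂ e' hJ₂ hLJ₂ hr' a
      cases b <;> cases c <;>
        simp only [LinearMap.coe_comp, Function.comp_apply, ContinuousLinearMap.coe_coe, LinearEquiv.coe_coe, h1, h2,
          h3, h4, map_neg, hg, h1', h2', h3', h4']
    have := LinearMap.congr_fun key v
    simpa using this

/-- **Proposition 1.3 (linear form): the centraliser `G_L ≅ GL(V, L)` of a complex structure `L` acts transitively on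
the set `N_L` of complex structures anticommuting with `L`** — for `J, J'` both anticommuting with `L` there is a linear
automorphism `g` COMMUTING with `L` and conjugating `J` to `J'` (`gJ = J'g`): Lemma 4.1's `g` for the pairs `(L, J)`,
`(L, J')`. [cite: BuskinIzadi2020TwistorLinesTori, §1.3 Prop. 1.3 (p.6 L42–47: "The group G_I acts transitively on the
set N_I of complex structures anticommuting with I. Proof. … G_I ≅ GL(V) … acts transitively on the set of bases as in
Paragraph 1.2, hence also on the set of J anti-commuting with I.")] -/
theorem exists_conj_of_anticommuting [FiniteDimensional ℝ F] (L J J' : F →L[ℝ] F) (hL : ∀ v, L (L v) = -v)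
    (hJ : ∀ v, J (J v) = -v) (hLJ : ∀ v, J (L v) = -L (J v)) (hJ' : ∀ v, J' (J' v) = -v)
    (hLJ' : ∀ v, J' (L v) = -L (J' v)) :
    ∃ g : F ≃L[ℝ] F, (∀ v, g (L v) = L (g v)) ∧ ∀ v, g (J v) = J' (g v) :=
  exists_conj_of_pair L J L J' hL hJ hLJ hL hJ' hLJ'

end Pair

/-! ### §8 Orientation: `G_I ≅ GL(V) < GL⁺(V_ℝ)`, and Lemma 4.1 in the `GL⁺(V_ℝ)` form of arXiv v1 -/

section Orientation

/-- Transport lemma: with an adapted basis of `L` in hand, identify `(F, L)` with `(ℂ^m, i)`; a real automorphism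
commuting with `L` becomes `ℂ`-linear, so `det_ℝ = |det_ℂ|² > 0`. [cite: BuskinIzadi2020TwistorLinesTori, §1.3 p.6
L44–45 ("`G_I ≅ GL(V) < GL⁺(V_ℝ) = GL⁺_{4n}(ℝ)`"); `det_ℝ = |det_ℂ|²` is Mathlib's `LinearMap.det_restrictScalars`] -/
private theorem det_pos_of_comm_aux {L : F →L[ℝ] F} (hL : ∀ v, L (L v) = -v) {m : ℕ} {e : Fin m → F}
    (r : Basis (Bool × Fin m) ℝ F) (hr : ∀ s, r s = bif s.1 then L (e s.2) else e s.2) (c : F ≃L[ℝ] F)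
    (hc : ∀ v, c (L v) = L (c v)) : 0 < (c : F →L[ℝ] F).det := by
  classical
  -- the model `ℂ^m` with its real basis `(δ_a, i δ_a)_a`, indexed like `r`
  let σ : (Bool × Fin m) ≃ (Σ _ : Fin m, Fin 2) :=
    { toFun := fun s ↦ ⟨s.2, bif s.1 then 1 else 0⟩
      invFun := fun t ↦ (decide (t.2 = 1), t.1)
      left_inv := by rintro ⟨b, a⟩; cases b <;> rfl
      right_inv := by rintro ⟨a, j⟩; fin_cases j <;> rfl }
  let bV : Basis (Bool × Fin m) ℝ (Fin m → ℂ) := (Pi.basis fun _ : Fin m ↦ Complex.basisOneI).reindex σ.symm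
  have hbV : ∀ s, bV s = Pi.single s.2 (bif s.1 then Complex.I else 1) := by
    rintro ⟨b, a⟩
    cases b <;> simp [bV, σ, Basis.reindex_apply, Pi.basis_apply, Complex.coe_basisOneI]
  let Φ : F ≃ₗ[ℝ] (Fin m → ℂ) := r.equiv bV (Equiv.refl _)
  have hΦ : ∀ s, Φ (r s) = bV s := fun s ↦ by simp [Φ]
  -- multiplication by `i` on `ℂ^m`, as a real-linear map
  let mulI : (Fin m → ℂ) →ₗ[ℝ] (Fin m → ℂ) :=
    { toFun := fun w ↦ Complex.I • w
      map_add' := fun x y ↦ smul_add _ _ _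
      map_smul' := fun x w ↦ by ext a; simp [Complex.real_smul, mul_left_comm] }
  have hmulI : ∀ w, mulI w = Complex.I • w := fun w ↦ rfl
  -- `Φ` intertwines `L` with multiplication by `i`
  have hΦL : ∀ v, Φ (L v) = Complex.I • Φ v := by
    intro v
    have key : (Φ.toLinearMap ∘ₗ (L : F →ₗ[ℝ] F)) = mulI ∘ₗ Φ.toLinearMap := by
      refine r.ext fun s ↦ ?_
      obtain ⟨b, a⟩ := s
      cases b
      · have e1 : L (r (false, a)) = r (true, a) := by rw [hr, hr]; rfl
        simp only [LinearMap.coe_comp, Function.comp_apply, ContinuousLinearMap.coe_coe, LinearEquiv.coe_coe, e1, hΦ,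
          hmulI, hbV]
        ext j; by_cases h : j = a <;> simp [h]
      · have e1 : L (r (true, a)) = -r (false, a) := by rw [hr, hr]; simp [hL]
        simp only [LinearMap.coe_comp, Function.comp_apply, ContinuousLinearMap.coe_coe, LinearEquiv.coe_coe, e1,
          map_neg, hΦ, hmulI, hbV]
        ext j; by_cases h : j = a <;> simp [h]
    simpa [hmulI] using LinearMap.congr_fun key v
  have hΦL' : ∀ w, Φ.symm (Complex.I • w) = L (Φ.symm w) := fun w ↦ by
    apply Φ.injective
    rw [LinearEquiv.apply_symm_apply, hΦL, LinearEquiv.apply_symm_apply]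
  -- the conjugate `c' = Φ c Φ⁻¹` commutes with `i`, hence is `ℂ`-linear
  let c' : (Fin m → ℂ) →ₗ[ℝ] (Fin m → ℂ) :=
    (Φ : F →ₗ[ℝ] (Fin m → ℂ)) ∘ₗ ((c : F →L[ℝ] F) : F →ₗ[ℝ] F) ∘ₗ (Φ.symm : (Fin m → ℂ) →ₗ[ℝ] F)
  have hc'apply : ∀ w, c' w = Φ (c (Φ.symm w)) := fun w ↦ rfl
  have hc'I : ∀ w, c' (Complex.I • w) = Complex.I • c' w := fun w ↦ by
    rw [hc'apply, hc'apply, hΦL', hc, hΦL]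
  have hz : ∀ (z : ℂ) (u : Fin m → ℂ), z • u = (z.re : ℝ) • u + (z.im : ℝ) • (Complex.I • u) := fun z u ↦ by
    ext a
    simp only [Pi.smul_apply, Pi.add_apply, Complex.real_smul, smul_eq_mul]
    rw [← mul_assoc, ← add_mul, Complex.re_add_im]
  let f : (Fin m → ℂ) →ₗ[ℂ] (Fin m → ℂ) :=
    { toFun := c'
      map_add' := c'.map_add
      map_smul' := fun z w ↦ by
        show c' (z • w) = z • c' w
        rw [hz z w, hz z (c' w), map_add, map_smul, map_smul, hc'I] }
  have hf : LinearMap.det c' = LinearMap.det (f.restrictScalars ℝ) := by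
    congr 1
  -- determinants: `det c = det c' = |det_ℂ f|² ≥ 0`, and `det c ≠ 0`
  have h1 : (c : F →L[ℝ] F).det = LinearMap.det c' := (LinearMap.det_conj _ Φ).symm
  have h2 : LinearMap.det c' = Complex.normSq (LinearMap.det f) := by
    rw [hf, LinearMap.det_restrictScalars, Algebra.norm_complex_apply]
  have h3 : (c : F →L[ℝ] F).det ≠ 0 := (c.toLinearEquiv.isUnit_det').ne_zero
  rw [h1] at h3 ⊢
  exact lt_of_le_of_ne (h2 ▸ Complex.normSq_nonneg _) h3.symm

/-- **`G_I ≅ GL(V) < GL⁺(V_ℝ)`**: a real-linear automorphism commuting with a complex structure `L` of a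
finite-dimensional real space has POSITIVE determinant (`(F, L) ≅ (ℂ^m, i)` makes it `ℂ`-linear, and
`det_ℝ = |det_ℂ|²`). [cite: BuskinIzadi2020TwistorLinesTori, §1.2 p.6 L3 and §1.3 proof of Prop. 1.3, p.6 L44–45
("The group `G_I ≅ GL(V) < GL⁺(V_ℝ) = GL⁺_{4n}(ℝ)`"); the same sentence is in arXiv v1 §1.2] -/
theorem det_pos_of_commute_complexStructure [FiniteDimensional ℝ F] (L : F →L[ℝ] F) (hL : ∀ v, L (L v) = -v)
    (c : F ≃L[ℝ] F) (hc : ∀ v, c (L v) = L (c v)) : 0 < (c : F →L[ℝ] F).det := by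
  obtain ⟨m, e, r, hr⟩ := exists_adapted_basis L hL
  exact det_pos_of_comm_aux hL r hr c hc

/-- **All conjugators between two complex structures have the same orientation behaviour**: if `g₁ L₁ = L₂ g₁` and
`g₂ L₁ = L₂ g₂` then `det g₁ · det g₂ > 0` (`g₂ g₁⁻¹ ∈ G_{L₂} < GL⁺(V_ℝ)`) — the linear-algebra content of "`Compl`
consists of two connected components `Compl⁺` and `Compl⁻`, corresponding to the components `GL⁺(V_ℝ)` and `GL⁻(V_ℝ)`
of `G`": the conjugators of `L₁` onto `L₂` lie in ONE component of `GL(V_ℝ)`. [cite: BuskinIzadi2020TwistorLinesTori,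
§1.1 arXiv v2 p.5 L35–36 (two components), §1.3 p.6 L44–45 (`G_I < GL⁺(V_ℝ)`)] -/
theorem det_mul_det_pos_of_conj [FiniteDimensional ℝ F] (L₁ L₂ : F →L[ℝ] F) (hL₂ : ∀ v, L₂ (L₂ v) = -v)
    (g₁ g₂ : F ≃L[ℝ] F) (h₁ : ∀ v, g₁ (L₁ v) = L₂ (g₁ v)) (h₂ : ∀ v, g₂ (L₁ v) = L₂ (g₂ v)) :
    0 < (g₁ : F →L[ℝ] F).det * (g₂ : F →L[ℝ] F).det := by
  -- `g₂ g₁⁻¹` commutes with `L₂`, hence has positive determinant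
  have hs : ∀ v, g₁.symm (L₂ v) = L₁ (g₁.symm v) := fun v ↦ by
    rw [g₁.symm_apply_eq, h₁, g₁.apply_symm_apply]
  have hc : ∀ v, (g₁.symm.trans g₂) (L₂ v) = L₂ ((g₁.symm.trans g₂) v) := fun v ↦ by
    show g₂ (g₁.symm (L₂ v)) = L₂ (g₂ (g₁.symm v))
    rw [hs, h₂]
  have hpos := det_pos_of_commute_complexStructure L₂ hL₂ (g₁.symm.trans g₂) hc
  have hcomp : ((g₁.symm.trans g₂ : F ≃L[ℝ] F) : F →L[ℝ] F) = (g₂ : F →L[ℝ] F).comp (g₁.symm : F →L[ℝ] F) :=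
    ContinuousLinearMap.ext fun _ ↦ rfl
  rw [hcomp] at hpos
  change 0 < LinearMap.det (((g₂ : F →L[ℝ] F) : F →ₗ[ℝ] F) ∘ₗ ((g₁.symm : F →L[ℝ] F) : F →ₗ[ℝ] F)) at hpos
  rw [LinearMap.det_comp] at hpos
  -- `det g₁ · det g₁⁻¹ = 1`
  have hd : LinearMap.det ((g₁ : F →L[ℝ] F) : F →ₗ[ℝ] F) * LinearMap.det ((g₁.symm : F →L[ℝ] F) : F →ₗ[ℝ] F) = 1 :=
    g₁.toLinearEquiv.det_mul_det_symm
  have hd0 : LinearMap.det ((g₁ : F →L[ℝ] F) : F →ₗ[ℝ] F) ≠ 0 := (g₁.toLinearEquiv.isUnit_det').ne_zero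
  have key : (g₁ : F →L[ℝ] F).det * (g₂ : F →L[ℝ] F).det =
      LinearMap.det ((g₂ : F →L[ℝ] F) : F →ₗ[ℝ] F) * LinearMap.det ((g₁.symm : F →L[ℝ] F) : F →ₗ[ℝ] F) *
        (LinearMap.det ((g₁ : F →L[ℝ] F) : F →ₗ[ℝ] F) * LinearMap.det ((g₁ : F →L[ℝ] F) : F →ₗ[ℝ] F)) := by
    change LinearMap.det ((g₁ : F →L[ℝ] F) : F →ₗ[ℝ] F) * LinearMap.det ((g₂ : F →L[ℝ] F) : F →ₗ[ℝ] F) = _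
    linear_combination (-(LinearMap.det ((g₂ : F →L[ℝ] F) : F →ₗ[ℝ] F)) *
      LinearMap.det ((g₁ : F →L[ℝ] F) : F →ₗ[ℝ] F)) * hd
  rw [key]
  exact mul_pos hpos (mul_self_pos.mpr hd0)

/-- **Lemma 4.1 in the `GL⁺` form (arXiv v1: "`G := GL⁺(V_ℝ)` … `Compl = G·I`"; "The group `G = GL⁺(V_ℝ)` acts
transitively on the set of twistor lines in `Compl`")** — if `(L₁, J₁)`, `(L₂, J₂)` are quaternionic pairs and `L₂`
lies in the `GL⁺(V_ℝ)`-orbit of `L₁` (`L₂ = h L₁ h⁻¹` with `det h > 0`, i.e. both in the same `Compl = G·I`), then ONE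
orientation-preserving `g` conjugates the pair: `det g > 0`, `g L₁ = L₂ g`, `g J₁ = J₂ g` (`L₁² = −1` is
then automatic and not assumed). The proof is the printed
one: move `L₁` to `L₂` by `h`, then use `G_{L₂}`-transitivity on `N_{L₂}` (`exists_conj_of_anticommuting`) and
`G_{L₂} < GL⁺(V_ℝ)` (`det_pos_of_commute_complexStructure`). The orbit hypothesis cannot be dropped: on `ℍ = ℝ⁴`
left and right multiplication by `i` are conjugate only by orientation-reversing maps
(`quaternion_det_neg_of_conj_left_right`, `exists_pairs_forall_conj_det_neg` below).
[cite: BuskinIzadi2020TwistorLinesTori, §4 Lemma 4.1 — arXiv v2 p.21 L32–36 with `G = GL(V_ℝ)` (v2 §1.1 p.5 L31–36: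
"`G := GL(V_ℝ)` … `Compl` consists of two connected components `Compl⁺` and `Compl⁻`, corresponding to the components
`GL⁺(V_ℝ)` and `GL⁻(V_ℝ)` of `G`"); arXiv v1 (2018, the held corpus text) §1.1/§4: "`G := GL⁺(V_ℝ)` … `Compl = G·I`",
"The group `G = GL⁺(V_ℝ)` acts transitively on the set of twistor lines in `Compl`. Proof. Given two twistor spheres
`S₁ = S(I₁, J₁)` and `S₂ = S(I₂, J₂)`, there is an element `g ∈ G` sending `I₁` to `I₂` … The lemma now follows from
Corollary 1.5" (v1 numbering: Prop. 1.2 / Cor. 1.5 = v2 Prop. 1.3 / Cor. 1.6); journal pages unseen (acq-10291)] -/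
theorem exists_conj_of_pair_of_det_pos [FiniteDimensional ℝ F] (L₁ J₁ L₂ J₂ : F →L[ℝ] F)
    (hJ₁ : ∀ v, J₁ (J₁ v) = -v) (hLJ₁ : ∀ v, J₁ (L₁ v) = -L₁ (J₁ v)) (hL₂ : ∀ v, L₂ (L₂ v) = -v)
    (hJ₂ : ∀ v, J₂ (J₂ v) = -v) (hLJ₂ : ∀ v, J₂ (L₂ v) = -L₂ (J₂ v))
    (horbit : ∃ h : F ≃L[ℝ] F, 0 < (h : F →L[ℝ] F).det ∧ ∀ v, h (L₁ v) = L₂ (h v)) :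
    ∃ g : F ≃L[ℝ] F, 0 < (g : F →L[ℝ] F).det ∧ (∀ v, g (L₁ v) = L₂ (g v)) ∧ ∀ v, g (J₁ v) = J₂ (g v) := by
  obtain ⟨h, hdet, hL⟩ := horbit
  -- `J' := h J₁ h⁻¹` is a complex structure anticommuting with `L₂ = h L₁ h⁻¹`
  let J' : F →L[ℝ] F := (h : F →L[ℝ] F).comp (J₁.comp (h.symm : F →L[ℝ] F))
  have hJ'apply : ∀ v, J' v = h (J₁ (h.symm v)) := fun v ↦ rfl
  have hsymmL : ∀ v, h.symm (L₂ v) = L₁ (h.symm v) := fun v ↦ by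
    rw [h.symm_apply_eq, hL, h.apply_symm_apply]
  have hJ' : ∀ v, J' (J' v) = -v := fun v ↦ by
    rw [hJ'apply, hJ'apply, h.symm_apply_apply, hJ₁, map_neg, h.apply_symm_apply]
  have hLJ' : ∀ v, J' (L₂ v) = -L₂ (J' v) := fun v ↦ by
    rw [hJ'apply, hJ'apply, hsymmL, hLJ₁, map_neg, hL]
  -- `G_{L₂}` moves `J'` to `J₂`, with positive determinant
  obtain ⟨g', hg'L, hg'J⟩ := exists_conj_of_anticommuting L₂ J' J₂ hL₂ hJ' hLJ' hJ₂ hLJ₂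
  have hg'det := det_pos_of_commute_complexStructure L₂ hL₂ g' hg'L
  refine ⟨h.trans g', ?_, fun v ↦ ?_, fun v ↦ ?_⟩
  · have hcomp : ((h.trans g' : F ≃L[ℝ] F) : F →L[ℝ] F) = (g' : F →L[ℝ] F).comp (h : F →L[ℝ] F) :=
      ContinuousLinearMap.ext fun _ ↦ rfl
    rw [hcomp]
    show 0 < LinearMap.det (((g' : F →L[ℝ] F) : F →ₗ[ℝ] F) ∘ₗ ((h : F →L[ℝ] F) : F →ₗ[ℝ] F))
    rw [LinearMap.det_comp]
    exact mul_pos hg'det hdet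
  · show g' (h (L₁ v)) = L₂ (g' (h v))
    rw [hL, hg'L]
  · show g' (h (J₁ v)) = J₂ (g' (h v))
    rw [← hg'J, hJ'apply, h.symm_apply_apply]

end Orientation

/-! ### §8b The `GL⁺`-orbit hypothesis is needed: left versus right quaternion multiplication on `ℍ = ℝ⁴` -/

section QuaternionExample

open Quaternion

/-- **On `ℍ = ℝ⁴`, left and right multiplication by `i` are complex structures conjugate ONLY by orientation-reversing
maps**: every `g ∈ GL(ℍ_ℝ)` with `g(iq) = g(q)i` has `det g < 0` (one conjugator is `a + bi + cj + dk ↦ a + bi + cj − dk`,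
of determinant `−1`, and all conjugators have determinants of one sign, `det_mul_det_pos_of_conj`). This is the
example behind the two components `Compl^±` of arXiv v2 §1.1 (p.5 L35–36) in the lowest dimension.
[cite: BuskinIzadi2020TwistorLinesTori, §1.1 arXiv v2 p.5 L35–36 ("two connected components `Compl⁺` and `Compl⁻`,
corresponding to the components `GL⁺(V_ℝ)` and `GL⁻(V_ℝ)`"); the explicit `ℍ` example is folklore] -/
theorem quaternion_det_neg_of_conj_left_right (g : ℍ ≃L[ℝ] ℍ)
    (hg : ∀ q : ℍ, g ((Complex.I : ℍ) * q) = g q * (Complex.I : ℍ)) : (g : ℍ →L[ℝ] ℍ).det < 0 := by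
  -- the two complex structures `q ↦ iq`, `q ↦ qi` (`i = ⟨0, 1, 0, 0⟩`, the image of `Complex.I`)
  let L₁ : ℍ →L[ℝ] ℍ := (LinearMap.mulLeft ℝ (Complex.I : ℍ)).toContinuousLinearMap
  let L₂ : ℍ →L[ℝ] ℍ := (LinearMap.mulRight ℝ (Complex.I : ℍ)).toContinuousLinearMap
  have hL₁ : ∀ q, L₁ q = (Complex.I : ℍ) * q := fun q ↦ rfl
  have hL₂ : ∀ q, L₂ q = q * (Complex.I : ℍ) := fun q ↦ rfl
  have hii : (Complex.I : ℍ) * (Complex.I : ℍ) = -1 := by ext <;> simp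
  have hL₂sq : ∀ q, L₂ (L₂ q) = -q := fun q ↦ by
    rw [hL₂, hL₂, mul_assoc, hii, mul_neg, mul_one]
  -- the explicit conjugator `g₀ : a + bi + cj + dk ↦ a + bi + cj − dk`
  let g₀ₗ : ℍ ≃ₗ[ℝ] ℍ :=
    { toFun := fun q ↦ ⟨q.re, q.imI, q.imJ, -q.imK⟩
      invFun := fun q ↦ ⟨q.re, q.imI, q.imJ, -q.imK⟩
      map_add' := fun x y ↦ by ext <;> simp [add_comm]
      map_smul' := fun c x ↦ by ext <;> simp
      left_inv := fun q ↦ by ext <;> simp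
      right_inv := fun q ↦ by ext <;> simp }
  let g₀ : ℍ ≃L[ℝ] ℍ := g₀ₗ.toContinuousLinearEquiv
  have hg₀ : ∀ q : ℍ, g₀ q = ⟨q.re, q.imI, q.imJ, -q.imK⟩ := fun q ↦ rfl
  have hg₀conj : ∀ q, g₀ (L₁ q) = L₂ (g₀ q) := fun q ↦ by
    rw [hL₁, hL₂, hg₀, hg₀]
    ext <;> simp
  have hgconj : ∀ q, g (L₁ q) = L₂ (g q) := fun q ↦ by rw [hL₁, hL₂]; exact hg q
  -- `det g₀ = -1`: its matrix in the basis `(1, i, j, k)` is `diag(1, 1, 1, -1)`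
  let b : Basis (Fin 4) ℝ ℍ := QuaternionAlgebra.basisOneIJK (R := ℝ) (-1) 0 (-1)
  have hbrepr : ∀ q : ℍ, ⇑(b.repr q) = ![q.re, q.imI, q.imJ, q.imK] := fun q ↦
    QuaternionAlgebra.coe_basisOneIJK_repr (R := ℝ) (c₁ := -1) (c₂ := 0) (c₃ := -1) q
  have hb : ∀ j, b j =
      ⟨if j = 0 then 1 else 0, if j = 1 then 1 else 0, if j = 2 then 1 else 0, if j = 3 then 1 else 0⟩ := fun j ↦ by
    rw [Basis.apply_eq_iff]
    ext k
    rw [hbrepr]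
    fin_cases j <;> fin_cases k <;> simp
  have hmat : LinearMap.toMatrix b b ((g₀ : ℍ →L[ℝ] ℍ) : ℍ →ₗ[ℝ] ℍ) = Matrix.diagonal ![1, 1, 1, -1] := by
    ext i j
    rw [LinearMap.toMatrix_apply, hbrepr, hb]
    fin_cases i <;> fin_cases j <;> simp [hg₀, Matrix.diagonal]
  have hdet₀ : (g₀ : ℍ →L[ℝ] ℍ).det = -1 := by
    show LinearMap.det ((g₀ : ℍ →L[ℝ] ℍ) : ℍ →ₗ[ℝ] ℍ) = -1
    rw [← LinearMap.det_toMatrix b, hmat, Matrix.det_diagonal]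
    simp [Fin.prod_univ_four]
  have := det_mul_det_pos_of_conj L₁ L₂ hL₂sq g g₀ hgconj hg₀conj
  rw [hdet₀] at this
  linarith

/-- **Sharpness of the `GL⁺` form of Lemma 4.1**: there are quaternionic pairs `(L₁, J₁)`, `(L₂, J₂)` on `ℍ = ℝ⁴` —
left multiplication by `i, j` and right multiplication by `i, j` — such that EVERY conjugator of `L₁` onto `L₂` (let
alone of the pairs) reverses orientation; in particular no orientation-preserving `g` conjugates `(L₁, J₁)` to
`(L₂, J₂)`: the "`G = GL⁺(V_ℝ)`" form of Lemma 4.1 (arXiv v1) needs v1's "`Compl = G·I`" (one `GL⁺`-orbit), while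
arXiv v2 prints `G = GL(V_ℝ)` for its two-component `Compl` (`exists_conj_of_pair`).
[cite: BuskinIzadi2020TwistorLinesTori, §1.1 arXiv v2 p.5 L31–36 vs arXiv v1 §1.1 ("`G := GL⁺(V_ℝ)` … `Compl = G·I`");
the `ℍ` example is folklore] -/
theorem exists_pairs_forall_conj_det_neg : ∃ L₁ J₁ L₂ J₂ : ℍ →L[ℝ] ℍ, (∀ v, L₁ (L₁ v) = -v) ∧ (∀ v, J₁ (J₁ v) = -v) ∧
    (∀ v, J₁ (L₁ v) = -L₁ (J₁ v)) ∧ (∀ v, L₂ (L₂ v) = -v) ∧ (∀ v, J₂ (J₂ v) = -v) ∧ (∀ v, J₂ (L₂ v) = -L₂ (J₂ v)) ∧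
    ∀ g : ℍ ≃L[ℝ] ℍ, (∀ v, g (L₁ v) = L₂ (g v)) → (g : ℍ →L[ℝ] ℍ).det < 0 := by
  let qi : ℍ := ⟨0, 1, 0, 0⟩
  let qj : ℍ := ⟨0, 0, 1, 0⟩
  have hii : qi * qi = -1 := by ext <;> simp [qi]
  have hjj : qj * qj = -1 := by ext <;> simp [qj]
  have hij : qj * qi = -(qi * qj) := by ext <;> simp [qi, qj]
  refine ⟨(LinearMap.mulLeft ℝ qi).toContinuousLinearMap, (LinearMap.mulLeft ℝ qj).toContinuousLinearMap,
    (LinearMap.mulRight ℝ qi).toContinuousLinearMap, (LinearMap.mulRight ℝ qj).toContinuousLinearMap,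
    fun v ↦ ?_, fun v ↦ ?_, fun v ↦ ?_, fun v ↦ ?_, fun v ↦ ?_, fun v ↦ ?_, fun g hg ↦ ?_⟩
  · show qi * (qi * v) = -v
    rw [← mul_assoc, hii, neg_one_mul]
  · show qj * (qj * v) = -v
    rw [← mul_assoc, hjj, neg_one_mul]
  · show qj * (qi * v) = -(qi * (qj * v))
    rw [← mul_assoc, hij, neg_mul, mul_assoc]
  · show v * qi * qi = -v
    rw [mul_assoc, hii, mul_neg, mul_one]
  · show v * qj * qj = -v
    rw [mul_assoc, hjj, mul_neg, mul_one]
  · show v * qi * qj = -(v * qj * qi)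
    rw [mul_assoc, mul_assoc, hij, mul_neg, neg_neg]
  · exact quaternion_det_neg_of_conj_left_right g fun q ↦ hg q

end QuaternionExample

/-! ### §9 The `𝔤₀`-faithful torus form of Verbitsky's Remark 4.3

With §4–§5, the hypothesis of `NoFormsInvariantUnderAllComplexStructures.lean` ("fixed by EVERY complex structure") may
be weakened to "fixed by every complex structure that is compatible with some linear hyperkähler structure
`(L, J, g)`" — which is what `𝔤₀`-invariance gives (Verbitsky 2008 §4, p.668 L3–10: `𝔤₀` is "generated by `u_I`, for
all complex structures `I` which are compatible with some hyperkähler structure") — because in real dimension `4n`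
every complex structure is so compatible. -/

/-- **Torus half of Verbitsky's Rem. 4.3, `𝔤₀`-faithful form:** on a real space of dimension `4n`, a `k`-covector
(`0 < k < 4n`) fixed by every complex structure `L` that is part of a linear hyperkähler structure `(L, J, g)` (`J`
anticommuting with `L`, `g` a symmetric positive definite form invariant under `L` and `J`) vanishes — since EVERY `L`
is (`exists_hyperkaehler_of_finrank_eq`), this is `AllComplexStructures.eq_zero_of_forall_complexStructure_invariant`.
[cite: Verbitsky2008CoherentSheavesK3Tori, §4 Rem. 4.3 (p.668 L23–24) with p.668 L3–10; BuskinIzadi2020TwistorLinesTori,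
§1.2 Prop. 1.2 (p.6 L29–34)] -/
theorem eq_zero_of_forall_hyperkaehlerCompatible_invariant {W : Type*} [NormedAddCommGroup W] [NormedSpace ℝ W]
    [FiniteDimensional ℝ F] {n k : ℕ} (hF : finrank ℝ F = 4 * n) (hk : 0 < k) (hkn : k < 4 * n)
    (β : F [⋀^Fin k]→L[ℝ] W)
    (hβ : ∀ (L J : F →L[ℝ] F) (g : F →L[ℝ] F →L[ℝ] ℝ), (∀ v, L (L v) = -v) → (∀ v, J (J v) = -v) →
      (∀ v, J (L v) = -L (J v)) → (∀ x y, g x y = g y x) → (∀ x, x ≠ 0 → 0 < g x x) →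
      (∀ x y, g (L x) (L y) = g x y) → (∀ x y, g (J x) (J y) = g x y) → β.compContinuousLinearMap L = β) :
    β = 0 :=
  AllComplexStructures.eq_zero_of_forall_complexStructure_invariant (m := 2 * n) (by rw [hF]; ring) hk (by omega) β
    fun L hL ↦ by
      obtain ⟨J, g, hJ, hLJ, h1, h2, h3, h4⟩ := exists_hyperkaehler_of_finrank_eq hF L hL
      exact hβ L J g hL hJ hLJ h1 h2 h3 h4

end Literature.Geometry.Hyperkaehler.ComplexStructure
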